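import Summits.RiemannHypothesis.RiemannHypothesis.Theorems.SuzukiSharpRadiusXiAtOne
import Literature.NumberTheory.LFunctions.LagariasXiPositivityZeros
import Literature.NumberTheory.LFunctions.LagariasXiPositivityGamma

/-!
# SuzukiSharpRadius — rung 2: the one-line minimum of `Re ξ'/ξ` on `Re s = 2` (column DBR; RH-FREE)

RH-FREE throughout; nothing here bears on the truth of RH (a clean window certifies nothing about RH).

Third proof file of the cell rh-dbr's theory target T-LCR⋆ (`Theorems.SuzukiSharpRadiusDefs`, S2 on ONE line).
PROVED HERE, unconditionally and WITHOUT any located zero or cited zero fact: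

* `xiLogDerivMinOnAxisAt_two : XiLogDerivMinOnAxisAt 2` — for every real `u`,
  `Re ξ'/ξ(2) ≤ Re ξ'/ξ(2 + iu)`: the minimum over `u` of `Re ξ'/ξ(2+iu)` is attained at `u = 0`.
  - `u² ≤ 576` (§1, the ZERO SIDE): the tree's unconditional partial fraction with multiplicities
    `Re ξ'/ξ(s) = Σ_ρ m(ρ) Re 1/(s−ρ)` (`hasSum_zeroOrder_mul_re_inv_sub`, at `ζ(s) ≠ 0`), averaged over
    `s = 2 ± iu` (the two real parts agree, `Lagarias1999.re_logDeriv_riemannXi_neg`), and Lagarias' real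
    inequality `a/(a²+(u−γ)²) + a/(a²+(u+γ)²) ≥ 2a/(a²+γ²)` for `a² + u² ≤ 3γ²`
    (`Lagarias1999.two_mul_div_le_add`) termwise with `a = 2 − Re ρ ∈ (1,2)` and `γ² > 196`
    (`Lagarias1999.sq_im_gt`, i.e. the kernel-checked `N(14) = 0` of `FordL33.fourteen_lt_abs_im`):
    `a² + u² < 4 + 576 = 580 ≤ 588 < 3γ²`.
  - `576 ≤ u²` (§2, the GAMMA SIDE): Lagarias' master inequality on `Re s > 1`
    (`Lagarias1999.re_logDeriv_riemannXi_ofReal_le_of_sum_ge`: explicit formula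
    `ξ'/ξ = 1/s + 1/(s−1) − ½log π + ½ψ(s/2) − ΣΛ(n)n^{-s}`, prime side minimal at `u = 0`, digamma gain
    `Σ_k u²/((σ+2k)((σ+2k)²+u²))`) with `σ = 2` and `M = 40` gain terms: the hypothesis
    `1/(1+u²) ≤ Σ_{k=1}^{40} 1/((2k+2)((2k+2)²+u²))` holds for `u² ≥ 576` (ratio trick: each term's ratio
    to the left side increases with `u²`; at `u² = 576` the sum of ratios is `> 1.016`, `norm_num`).
* `xiLogDerivRe_two_zero_eq` — the Dirichlet-side closed form
  `ξ'/ξ(2) = 3/2 − (log π)/2 − γ/2 − Σ Λ(n)/n²` (`ΣΛ(n)/n² = −ζ'/ζ(2) = 0.569961…`, `ξ'/ξ(2) = 0.069066…`).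
The consequences for the clean radius — `LinearCleanRadiusBelow (xiLogDerivRe 2 0 / (3/2))` by eng-5's window
mechanism `linear_clean_radius_of_line_min` (`Theorems.SuzukiSharpRadius`), i.e. EVERY `c < (2/3)·ξ'/ξ(2) = 0.04604…`
(99.7 % of `c⋆ = 2 + γ − log 4π`) is a linear clean radius, and the prime-free value bound `ξ'/ξ(2) ≥ (291/98)ξ'/ξ(1)`
giving `97/98` of `c⋆` — are in the sibling file `Theorems.SuzukiSharpRadiusTwoValue`.

References: J. C. Lagarias, Acta Arith. 89 (1999) 217–234, §2 (2.13)–(2.22), §3 Lemmas 3.1–3.2;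
[Su20] M. Suzuki, ASPM 84 (2020) = arXiv:1907.07302, (1.9).  Cell memo TARGET-v7 §K.8 (rh-dbr-theory g7,
08:49Z/08:56Z corrections: "rung 2 is cite-free").
-/

noncomputable section

-- D-0017: `Summit.<S>.<S>.…` is the designed namespace of a single-problem summit.
set_option linter.dupNamespace false

open Complex LSeries
open scoped LSeries.notation ArithmeticFunction.vonMangoldt

namespace Summit.RiemannHypothesis.RiemannHypothesis.Theorems.SuzukiSharpRadius

open Literature.NumberTheory.LFunctions
open Summit.RiemannHypothesis.RiemannHypothesis.Theorems.SuzukiCleanRadius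

/-! ## §1 The zero side: `u² ≤ 576` -/

/-- RH-FREE.  `ζ(2 + iu) ≠ 0`. -/
theorem riemannZeta_two_add_ne_zero (u : ℝ) : riemannZeta (((2 : ℝ) : ℂ) + (u : ℂ) * I) ≠ 0 :=
  riemannZeta_ne_zero_of_one_le_re (by simp)

/-- RH-FREE.  `Re 1/(2 + iu − ρ) = (2 − β)/((2 − β)² + (u − γ)²)` for `ρ = β + iγ`. -/
theorem re_inv_two_add_sub (u : ℝ) (ρ : ℂ) :
    (1 / ((((2 : ℝ) : ℂ) + (u : ℂ) * I) - ρ)).re = (2 - ρ.re) / ((2 - ρ.re) ^ 2 + (u - ρ.im) ^ 2) := by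
  rw [IsHadamardSeq.re_inv_sub_eq, Complex.sq_norm, Complex.normSq_apply]
  simp only [sub_re, add_re, ofReal_re, mul_re, I_re, mul_zero, ofReal_im, I_im, mul_one, sub_self,
    add_zero, sub_im, add_im, mul_im, zero_add]
  ring

/-- **RH-FREE, the zero side** (Lagarias' Lemmas 3.1–3.2 made unconditional on the line `Re s = 2`):
for `u² ≤ 576`, `Re ξ'/ξ(2) ≤ Re ξ'/ξ(2 + iu)`.  Unconditional partial fraction with multiplicities, average
over `± u`, and `a/(a²+(u−γ)²) + a/(a²+(u+γ)²) ≥ 2a/(a²+γ²)` termwise (`a = 2 − Re ρ ∈ (1,2)`,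
`a² + u² < 580 ≤ 588 < 3γ²` since `|γ| > 14` for every non-trivial zero, kernel-checked `N(14) = 0`). -/
theorem re_logDeriv_riemannXi_two_le_of_sq_le {u : ℝ} (hu : u ^ 2 ≤ 576) :
    (logDeriv riemannXi ((2 : ℝ) : ℂ)).re ≤ (logDeriv riemannXi (((2 : ℝ) : ℂ) + (u : ℂ) * I)).re := by
  have hζ0 : riemannZeta ((2 : ℝ) : ℂ) ≠ 0 := riemannZeta_ne_zero_of_one_le_re (by simp)
  have h0 := hasSum_zeroOrder_mul_re_inv_sub hζ0
  have hp := hasSum_zeroOrder_mul_re_inv_sub (riemannZeta_two_add_ne_zero u)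
  have hn := hasSum_zeroOrder_mul_re_inv_sub (riemannZeta_two_add_ne_zero (-u))
  rw [Lagarias1999.re_logDeriv_riemannXi_neg] at hn
  have hsum := hp.add hn
  have h02 := h0.mul_left 2
  have hle := hasSum_le (fun ρ ↦ ?_) h02 hsum
  · linarith
  -- termwise comparison
  have hm := ZetaZeroSum.zeroOrder_nonneg ρ
  have hγ := Lagarias1999.sq_im_gt ρ
  have hβ1 := ZetaZeros.riemannZetaNontrivialZeros.re_lt_one ρ.2
  have e0 : (1 / (((2 : ℝ) : ℂ) - (ρ : ℂ))).re = (2 - (ρ : ℂ).re) / ((2 - (ρ : ℂ).re) ^ 2 + (ρ : ℂ).im ^ 2) := by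
    have := re_inv_two_add_sub 0 (ρ : ℂ)
    simp only [ofReal_zero, zero_mul, add_zero, zero_sub, even_two, Even.neg_pow] at this
    exact this
  have en : (-u - (ρ : ℂ).im) ^ 2 = (u + (ρ : ℂ).im) ^ 2 := by ring
  rw [e0, re_inv_two_add_sub, re_inv_two_add_sub, en]
  have ha : 0 < 2 - (ρ : ℂ).re := by linarith
  have h3 : (2 - (ρ : ℂ).re) ^ 2 + u ^ 2 ≤ 3 * (ρ : ℂ).im ^ 2 := by
    have hβ0 := ZetaZeros.riemannZetaNontrivialZeros.re_pos ρ.2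
    nlinarith
  have key := Lagarias1999.two_mul_div_le_add (t := u) (γ := (ρ : ℂ).im) ha h3
  nlinarith [key, hm]

/-! ## §2 The gamma side: `576 ≤ u²` -/

/-- RH-FREE (the ratio trick of Lagarias' Lemma 3.6, with a free threshold `T`): for `0 < d ≤ c` and `T ≤ t²`,
`[d(d²+T)/(c(c²+T))] · 1/(d(d²+t²)) ≤ 1/(c(c²+t²))` (the ratio of the two sides increases with `t²`). -/
theorem ratio_mul_le_of_le_sq {d c T t : ℝ} (hd : 0 < d) (hc : d ≤ c) (hT : 0 ≤ T) (ht : T ≤ t ^ 2) :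
    d * (d ^ 2 + T) / (c * (c ^ 2 + T)) * (1 / (d * (d ^ 2 + t ^ 2))) ≤ 1 / (c * (c ^ 2 + t ^ 2)) := by
  have hc0 : 0 < c := by linarith
  rw [div_mul_div_comm, mul_one, div_le_div_iff₀ (by positivity) (by positivity), one_mul]
  have hsq : d ^ 2 ≤ c ^ 2 := pow_le_pow_left₀ hd.le hc 2
  have key : (d ^ 2 + T) * (c ^ 2 + t ^ 2) ≤ (c ^ 2 + T) * (d ^ 2 + t ^ 2) := by nlinarith
  have := mul_le_mul_of_nonneg_left key (by positivity : (0 : ℝ) ≤ d * c)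
  nlinarith [this]

/-- RH-FREE (the numeric certificate, exact rational arithmetic): at `u² = 576` the first `40` digamma gain terms
beat the loss at the pole `s = 1`: `1 ≤ 577 · Σ_{k=1}^{40} 1/((2k+2)((2k+2)² + 576))` (`= 1.0164…`). -/
theorem gain_sum_ge_one :
    (1 : ℝ) ≤ (2 - 1) * ((2 - 1) ^ 2 + 576) *
      ∑ k ∈ Finset.range 40, 1 / (((2 : ℝ) + 2 * ((k + 1 : ℕ) : ℝ)) * (((2 : ℝ) + 2 * ((k + 1 : ℕ) : ℝ)) ^ 2 + 576)) := by
  simp only [Finset.sum_range_succ, Finset.sum_range_zero]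
  norm_num

/-- RH-FREE (hypothesis of the master inequality on `Re s = 2`): for `576 ≤ u²`,
`1/((2−1)((2−1)²+u²)) ≤ Σ_{k=1}^{40} 1/((2+2k)((2+2k)²+u²))`. -/
theorem pole_loss_le_gain_sum_two {u : ℝ} (hu : 576 ≤ u ^ 2) :
    1 / ((2 - 1) * ((2 - 1) ^ 2 + u ^ 2)) ≤
      ∑ k ∈ Finset.range 40, 1 / (((2 : ℝ) + 2 * (k + 1 : ℕ)) * (((2 : ℝ) + 2 * (k + 1 : ℕ)) ^ 2 + u ^ 2)) := by
  have hR : 0 ≤ 1 / ((2 - 1) * ((2 - 1) ^ 2 + u ^ 2)) := by positivity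
  -- termwise ratio trick
  have hterm : ∀ k ∈ Finset.range 40,
      (2 - 1) * ((2 - 1) ^ 2 + 576) * (1 / (((2 : ℝ) + 2 * ((k + 1 : ℕ) : ℝ)) * (((2 : ℝ) + 2 * ((k + 1 : ℕ) : ℝ)) ^ 2 + 576)))
        * (1 / ((2 - 1) * ((2 - 1) ^ 2 + u ^ 2))) ≤
      1 / (((2 : ℝ) + 2 * (k + 1 : ℕ)) * (((2 : ℝ) + 2 * (k + 1 : ℕ)) ^ 2 + u ^ 2)) := by
    intro k _
    have hk : (0 : ℝ) ≤ ((k + 1 : ℕ) : ℝ) := Nat.cast_nonneg _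
    have h := ratio_mul_le_of_le_sq (d := 2 - 1) (c := (2 : ℝ) + 2 * ((k + 1 : ℕ) : ℝ)) (T := 576) (t := u)
      (by norm_num) (by linarith) (by norm_num) hu
    rw [mul_one_div]
    rw [mul_one_div] at h
    convert h using 2
    ring
  have hfin := Finset.sum_le_sum hterm
  rw [← Finset.sum_mul, ← Finset.mul_sum] at hfin
  have hcR := mul_le_mul_of_nonneg_right gain_sum_ge_one hR
  linarith

/-- **RH-FREE, the gamma side** (Lagarias' master inequality on `Re s = 2`): for `576 ≤ u²`,
`Re ξ'/ξ(2) ≤ Re ξ'/ξ(2 + iu)` — explicit formula on `Re s > 1`, prime side minimal at `u = 0`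
(nonnegativity of `Λ`), and the digamma gain `Σ_{k=1}^{40}` beats the loss at the pole `s = 1`. -/
theorem re_logDeriv_riemannXi_two_le_of_le_sq {u : ℝ} (hu : 576 ≤ u ^ 2) :
    (logDeriv riemannXi ((2 : ℝ) : ℂ)).re ≤ (logDeriv riemannXi (((2 : ℝ) : ℂ) + (u : ℂ) * I)).re :=
  Lagarias1999.re_logDeriv_riemannXi_ofReal_le_of_sum_ge (σ := 2) (by norm_num) 40
    (pole_loss_le_gain_sum_two hu)

/-! ## §3 Rung 2: `XiLogDerivMinOnAxisAt 2` -/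

/-- **RH-FREE · RUNG 2 of the cell's clean-radius ladder, PROVED unconditionally and cite-free**:
`XiLogDerivMinOnAxisAt 2` — for every real `u`, `Re ξ'/ξ(2) ≤ Re ξ'/ξ(2 + iu)` (zero side for `u² ≤ 576`,
gamma side for `u² ≥ 576`).  Nothing here bears on the truth of RH. -/
theorem xiLogDerivMinOnAxisAt_two : XiLogDerivMinOnAxisAt 2 := by
  unfold XiLogDerivMinOnAxisAt xiLogDerivRe
  intro u
  rw [← logDeriv_apply, ← logDeriv_apply]
  have e0 : ((2 : ℝ) : ℂ) + ((0 : ℝ) : ℂ) * I = ((2 : ℝ) : ℂ) := by simp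
  rw [e0]
  rcases le_or_gt (u ^ 2) 576 with h | h
  · exact re_logDeriv_riemannXi_two_le_of_sq_le h
  · exact re_logDeriv_riemannXi_two_le_of_le_sq h.le

/-! ## §4 The closed form of `ξ'/ξ(2)` on the Dirichlet side (for the numeric value of the radius) -/

/-- RH-FREE.  `ξ'/ξ(2) = 3/2 − (log π)/2 − γ/2 − Re Σ Λ(n) n^{-2}` (explicit formula at `s = 2`, `ψ(1) = −γ`);
numerically `Σ Λ(n)/n² = −ζ'/ζ(2) = 0.569961…`, `ξ'/ξ(2) = 0.069066…`, radius `(2/3)·ξ'/ξ(2) = 0.046044…`. -/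
theorem xiLogDerivRe_two_zero_eq :
    xiLogDerivRe 2 0 = 3 / 2 - Real.log Real.pi / 2 - Real.eulerMascheroniConstant / 2 - (L ↗Λ (2 : ℂ)).re := by
  unfold xiLogDerivRe
  rw [← logDeriv_apply]
  have e0 : ((2 : ℝ) : ℂ) + ((0 : ℝ) : ℂ) * I = (2 : ℂ) := by simp
  have h2 : 1 < (2 : ℂ).re := by simp
  rw [e0, logDeriv_riemannXi_eq_of_one_lt_re h2]
  have hψ : digamma ((2 : ℂ) / 2) = -(Real.eulerMascheroniConstant : ℂ) := by
    rw [show (2 : ℂ) / 2 = 1 by norm_num, Complex.digamma_one]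
  rw [hψ]
  have hA : ((1 : ℂ) / 2).re = 1 / 2 := by simp
  have hB : ((1 : ℂ) / (2 - 1)).re = 1 := by norm_num
  simp only [add_re, sub_re, hA, hB, neg_re, ofReal_re, mul_re, div_ofNat_re, div_ofNat_im, ofReal_im,
    one_im, neg_im]
  ring

end Summit.RiemannHypothesis.RiemannHypothesis.Theorems.SuzukiSharpRadius

end
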